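import Summits.QuantumFields.YangMills.Theorems.BalabanUVNodesK2NamedJetsRemAt
import Summits.QuantumFields.BalabanUV.Gaps.EndSurvivorCensus

/-!
# `runs-given-b` — EDITION 3 sketch (crux idea on K2⁷ `stmt-QuantumFields-20543`, seat ym-nodeO-idea-4 gen 3)

Answer to CRIT-1 g3's verdict `Cruxes/EndpointGivenBR13SepCoPH/CRIT-1-runs-given-b.md` (commit e376b90efe77): the card SURVIVES as a RE-CUT with ONE
REQUIRED RESHAPE (R) «re-key 2ᴮ to the standing letter — κ AFTER θ, `θ.cβ` carried, END slope `θ.cβ·stepBal 2 F.L`, constant form = the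
run-restriction of DEF-1's ed.3 `RemAt … (c)` (p593586)» and one hygiene item (H) «`crux write` the Sketch».  This file IS (R)+(H):

* §1 (generic, split-free) the RUN-RESTRICTED twins of DEF-1's `ConstRemainder` and of (C): `RunConstRemainder β b r γ₀` (|β_{k+1}(g_0,…,g_k) − b_k| ≤ r
  at every prefix of every in-window solution of (0.20)) and `SurvCont β γ₀` (= the survivor-continuity letter of `Gaps/EndSurvivorCensus`, VERBATIM shape);
  box letters ⟹ run letters; «survivors are runs» transfers the run letter to the survivor traces; the END from {drift of `b`, `RunConstRemainder` with
  the cap `r ≤ s`, `SurvCont`} by the TREE's consumer `Gaps.EndSurvivorCensus.endpointExistence_of_survivorLetters_runwisePS_locUpper` BY NAME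
  (prior art g1-plan-2 ∕ pub-balaban-gaps — conceded in ed.2; nothing of §1 of ed.1/ed.2 is re-claimed).
* §2 the run-restricted letter AT THE RECORD, `RunRemAt F κ θ hP c` := DEF-1's `RemAt F κ θ hP c` with `ConstRemainder ↦ RunConstRemainder` and
  `BetaContH γ₀ ↦ SurvCont γ₀`, the per-scale ANCHOR kept box-wise (it is the identification clause, M per k, and the (D1) road keys on it —
  `d1AtShadowingJets_of_drift_of_anchor`); `RemAt → RunRemAt` BY NAME; the END at one record from `RunRemAt` + the bare drift.
* §3 the two stub TEXTS of edition 3 — 2ᴮ″ `RunRemAtSomeJetsGivenB` (κ AFTER θ, scale `θ.cβ`, the item's unity guard and (B) = `B16.EndStatementBPrinted`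
  as INPUTS) and 1ᴮ″ `D1AtRunShadowingJets` — and the composition to the crux decl BY NAME consuming `hU` and `hB`; 2′(DEF-1 ed.3) ⟹ 2ᴮ″ and the
  anchor-keyed (D1) use form ⟹ 1ᴮ″, both BY NAME.

HONEST FRAMING.  Bookkeeping over hypothesis SHAPES for a conditional finite-𝕋⁴ item (route `BalabanUVNodes`, R4 rung `BalabanLadder.UV`).  K2⁷ is NOT
closed; no estimate of Bałaban's is asserted or lowered; [Balaban1987RG1] Thm 2 ∕ (0.31) p. 259 (NODE O) is UNPROVED IN PRINT; R4 closes the conditional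
finite-𝕋⁴ rung `BalabanLadder.UV` only — NOT the continuum limit, NOT OS, NOT the mass gap, NOT Clay.  0 sorry · 0 axiom · 0 instance · 0 notation.
-/

noncomputable section

namespace Summit.QuantumFields.YangMills.Cruxes.EndpointGivenBR13SepCoPH.RunsGivenB3

open Finset
open scoped BigOperators
open Literature.MathematicalPhysics.QuantumFieldTheory.Balaban1983to89
open Literature.MathematicalPhysics.QuantumFieldTheory.Balaban1983to89.FlowStep
open Literature.MathematicalPhysics.QuantumFieldTheory.Balaban1983to89.DagBinding (EndpointExistence ForwardGenerated)
open Literature.MathematicalPhysics.QuantumFieldTheory.Balaban1983to89.T4Continuum (T4Family)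
open Literature.MathematicalPhysics.QuantumFieldTheory.Balaban1983to89.Beta.Drift (OneLoopDrift sum_Ico_ge_of_drift)
open Summit.QuantumFields.YangMills.Theorems.BalabanUVNodesK2JsOfRecord (StepColourData beta0OfJs)
open Summit.QuantumFields.YangMills.Theorems.BalabanUVNodesK2NamedJetsRemAt (RemAt ConstRemainder ScaleAnchor)
open Summit.QuantumFields.YangMills.Theorems.EndpointGivenBR13SepCoPH.Negative.RemNamedJets13FalseOfTwoNormalisations (oneLoopDrift_const_mul)
open Summit.QuantumFields.BalabanUV.Gaps.EndSurvivorCensus (endpointExistence_of_survivorLetters_runwisePS_locUpper survCont_of_betaContH)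
open Summit.QuantumFields.BalabanUV.Gaps.EndRunwiseShooting (Y_eq_of_run survives_of_run rgEqH_shoot_of_survives)

/-! ## §1 Generic, split-free: the run-restricted letters and the END they give (tree consumer BY NAME) -/

section Generic

variable {β : HBeta} {b : ℕ → ℝ}

/-- The SURVIVOR SET of level `γ₀` at scale `k` (the set of `Gaps/EndSurvivorCensus`, named): bare couplings `x ∈ ]0,γ₀]` whose clamped forward run
stays in the window `]0,γ₀]` up to `k`. [folklore] -/
def Survivors (β : HBeta) (γ₀ : ℝ) (k : ℕ) : Set ℝ :=
  {x : ℝ | 0 < x ∧ x ≤ γ₀ ∧ ∀ j, j ≤ k → 1 / γ₀ ^ 2 ≤ Y β γ₀ j x}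

/-- HYPOTHESIS SHAPE (never a fact): **THE RUN-WISE CONSTANT REMAINDER** — `|β_{k+1}(g_0,…,g_k) − b_k| ≤ r` at every prefix of every solution of (0.20)
up to `n` contained in `]0,γ₀]` (the run-restriction of DEF-1's `ConstRemainder`; [I] Thm 3 p. 264 reads β exactly along such runs). [cite: Balaban1987RG1, Thm 3 p.264 and (5.10) p.293] -/
def RunConstRemainder (β : HBeta) (b : ℕ → ℝ) (r γ₀ : ℝ) : Prop :=
  ∀ (n : ℕ) (gs : ℕ → ℝ), RGEqH n β gs → Step.InInterval γ₀ n gs → ∀ k, k ≤ n → |β k (prefixOf gs k) - b k| ≤ r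

/-- HYPOTHESIS SHAPE (never a fact): **RUN-WISE (C)** — the survivor-continuity letter of `Gaps/EndSurvivorCensus` (shape VERBATIM): each trace
`x ↦ β_k(clampPrefix β γ₀ k x)` is continuous ON the survivor set of level `γ₀` at scale `k`. [cite: Balaban1987RG1, §1 pp.263–264] -/
def SurvCont (β : HBeta) (γ₀ : ℝ) : Prop :=
  ∀ k : ℕ, ContinuousOn (fun x : ℝ => β k (clampPrefix β γ₀ k x)) (Survivors β γ₀ k)

/-- BOX ⟹ RUNS: a constant remainder on `]0,γ₀]`-histories restricts to the in-window run prefixes. [folklore] -/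
theorem runConstRemainder_of_constRemainder {r γ₀ : ℝ} (h : ConstRemainder β b r γ₀) : RunConstRemainder β b r γ₀ :=
  fun _n gs _ hI k hk => h k (prefixOf gs k) fun i => hI i ((Nat.lt_succ_iff.mp i.isLt).trans hk)

/-- BOX ⟹ SURVIVORS: (C) on the boxes gives (C) on the survivor sets (`Gaps.EndSurvivorCensus.survCont_of_betaContH` BY NAME). [folklore] -/
theorem survCont_of_betaContH' {γ₀ : ℝ} (hγ₀ : 0 < γ₀) (h : BetaContH γ₀ β) : SurvCont β γ₀ :=
  survCont_of_betaContH hγ₀ h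

/-- SURVIVORS ARE RUNS: at a survivor `x` of level `γ₀ > 0` at scale `k`, the clamped forward run is an in-window solution of (0.20) up to `k`
(`Gaps.EndRunwiseShooting.rgEqH_shoot_of_survives` BY NAME + the clamp's range). [folklore] -/
theorem run_of_survivor {γ₀ : ℝ} (hγ₀ : 0 < γ₀) {k : ℕ} {x : ℝ} (hx : x ∈ Survivors β γ₀ k) :
    RGEqH k β (fun i => gClamp γ₀ (Y β γ₀ i x)) ∧ Step.InInterval γ₀ k (fun i => gClamp γ₀ (Y β γ₀ i x)) :=
  ⟨rgEqH_shoot_of_survives hγ₀ hx.2.2, fun _ _ => ⟨gClamp_pos hγ₀ _, gClamp_le hγ₀ _⟩⟩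

/-- The run letter READ ON THE SURVIVOR TRACES: per-level bounds `β_k ≤ b_k + r` on the survivor sets. [folklore] -/
theorem survUpper_of_runConstRemainder {r γ₀ : ℝ} (hγ₀ : 0 < γ₀) (h : RunConstRemainder β b r γ₀) (k : ℕ) (x : ℝ)
    (hx0 : 0 < x) (hxγ : x ≤ γ₀) (hsurv : ∀ j, j ≤ k → 1 / γ₀ ^ 2 ≤ Y β γ₀ j x) :
    β k (clampPrefix β γ₀ k x) ≤ b k + r := by
  obtain ⟨hrg, hI⟩ := run_of_survivor (β := β) hγ₀ ⟨hx0, hxγ, hsurv⟩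
  have h1 := (abs_le.mp (h k _ hrg hI k le_rfl)).2
  have e : prefixOf (fun i => gClamp γ₀ (Y β γ₀ i x)) k = clampPrefix β γ₀ k x := rfl
  rw [e] at h1
  linarith

/-- **RUN-WISE (PS) FROM A DRIFT AND THE RUN-WISE CONSTANT REMAINDER WITH THE CAP `r ≤ s`**: along every in-window run, every window sum of the β's is
`≥ −2A` (drift `|Σ_{j<k} b_j − s k| ≤ A`; `Beta.Drift.sum_Ico_ge_of_drift` BY NAME).  No sign of any individual β is read. [cite: Balaban1987RG1, Thm 2 p.259 (first sentence) and (2.12)–(2.14) p.268] -/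
theorem runwisePS_of_drift_runConstRemainder {s A r γ₀ : ℝ} (hdrift : OneLoopDrift s A b) (hrem : RunConstRemainder β b r γ₀) (hr : r ≤ s) :
    ∀ (n : ℕ) (gs : ℕ → ℝ), RGEqH n β gs → Step.InInterval γ₀ n gs →
      ∀ k, k ≤ n → -(2 * A) ≤ ∑ j ∈ Finset.Ico k n, β j (prefixOf gs j) := by
  intro n gs hrg hI k hkn
  have hpt : ∀ j ∈ Finset.Ico k n, b j - r ≤ β j (prefixOf gs j) := by
    intro j hj
    have hjn : j ≤ n := (Finset.mem_Ico.mp hj).2.le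
    have := (abs_le.mp (hrem n gs hrg hI j hjn)).1
    linarith
  have hsum : ∑ j ∈ Finset.Ico k n, (b j - r) ≤ ∑ j ∈ Finset.Ico k n, β j (prefixOf gs j) := Finset.sum_le_sum hpt
  have hsplit : ∑ j ∈ Finset.Ico k n, (b j - r) = ∑ j ∈ Finset.Ico k n, b j - r * ((n : ℝ) - k) := by
    rw [Finset.sum_sub_distrib, Finset.sum_const, Nat.card_Ico, nsmul_eq_mul, Nat.cast_sub hkn]
    ring
  have hdr := sum_Ico_ge_of_drift hdrift hkn
  have hnk : (0 : ℝ) ≤ (n : ℝ) - k := by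
    have : (k : ℝ) ≤ n := by exact_mod_cast hkn
    linarith
  have hrs : r * ((n : ℝ) - k) ≤ s * ((n : ℝ) - k) := mul_le_mul_of_nonneg_right hr hnk
  linarith

/-- **★ ENDPOINT EXISTENCE FROM A DRIFT, THE RUN-WISE CONSTANT REMAINDER WITH THE CAP `r ≤ s`, AND RUN-WISE (C) ONLY** (forward-generated constructions):
the TREE's `Gaps.EndSurvivorCensus.endpointExistence_of_survivorLetters_runwisePS_locUpper` BY NAME (prior art: g1-plan-2 GEN 19 ∕ pub-balaban-gaps g1-p3),
fed the per-level survivor bounds `b_k + r` (`survUpper_of_runConstRemainder`) and the run-wise (PS) with `M := 2A` (`runwisePS_of_drift_runConstRemainder`).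
The run-restricted twin of DEF-1's `endpointExistence_of_drift_constRemainder_cont`. [cite: Balaban1987RG1, Thm 2 p.259 (first sentence) and (5.10) p.293] -/
theorem endpointExistence_of_drift_runConstRemainder_survCont {C : B12.Construction} (hgen : ForwardGenerated C β) {γ₀ s A r : ℝ} (hγ₀ : 0 < γ₀)
    (hdrift : OneLoopDrift s A b) (hrem : RunConstRemainder β b r γ₀) (hr : r ≤ s) (hsc : SurvCont β γ₀) : EndpointExistence C :=
  have hA : 0 ≤ A := hdrift.nonneg
  endpointExistence_of_survivorLetters_runwisePS_locUpper hgen hγ₀ (by positivity) hsc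
    (fun k => ⟨b k + r, fun x hx0 hxγ hsurv => survUpper_of_runConstRemainder hγ₀ hrem k x hx0 hxγ hsurv⟩)
    (runwisePS_of_drift_runConstRemainder hdrift hrem hr)

end Generic

/-! ## §2 The run-restricted letter AT THE RECORD (`N = 2`), read at a scale `c` — DEF-1's `RemAt` with its XL conjuncts restricted to runs -/

section Letter

/-- **THE RUN-RESTRICTED LETTER `RunRemAt F κ θ hP c`** (edition 3 of this card's 2ᴮ currency): DEF-1's `RemAt F κ θ hP c` (p593586) with the
constant remainder read ALONG THE IN-WINDOW RUNS of the datum's own construction (`RunConstRemainder`) and (C) read ON THE SURVIVOR SETS (`SurvCont`);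
the per-scale ANCHOR at `c • beta0OfJs F κ` is kept box-wise (identification clause; the (D1) road keys on it).  Same window `γ₀ ≤ θ.γ`, same cap
`s ≤ c · stepBal 2 F.L`, κ a letter, normalisation carried by `c` (the stub texts put `c := θ.cβ`).  A predicate, never a fact; print context
[I] Thm 3 p. 264 (β read along `0 < g_k ≤ γ, k = 0,…,K`), (2.12)–(2.14) p. 268, (5.10) p. 293. [folklore] -/
def RunRemAt (F : T4Family) (κ : StepColourData) (θ : Node00.Stage13HParams F 2) (hP : θ.Provisos₁₃SepCoPH F 2) (c : ℝ) : Prop :=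
  ∃ γ₀ s : ℝ, 0 < γ₀ ∧ γ₀ ≤ θ.γ ∧ s ≤ c * B12Normalization.stepBal 2 F.L ∧
    RunConstRemainder (Node00.datumOfRecord₁₃SepCoPH F 2 θ hP).βfun (fun k => c * beta0OfJs F κ k) s γ₀ ∧
    ScaleAnchor (Node00.datumOfRecord₁₃SepCoPH F 2 θ hP).βfun (fun k => c * beta0OfJs F κ k) ∧
    SurvCont (Node00.datumOfRecord₁₃SepCoPH F 2 θ hP).βfun γ₀

variable (F : T4Family) (κ : StepColourData) (θ : Node00.Stage13HParams F 2) (hP : θ.Provisos₁₃SepCoPH F 2)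

/-- **DEF-1's LETTER ⟹ THE RUN-RESTRICTED LETTER**, at every scale (2ᴮ″ is weaker than 2′ BY NAME). [folklore] -/
theorem runRemAt_of_remAt {c : ℝ} (h : RemAt F κ θ hP c) : RunRemAt F κ θ hP c := by
  obtain ⟨γ₀, s, hγ₀, hγθ, hcap, hrem, hanch, hcont⟩ := h
  exact ⟨γ₀, s, hγ₀, hγθ, hcap, runConstRemainder_of_constRemainder hrem, hanch, survCont_of_betaContH' hγ₀ hcont⟩

/-- **★ THE END AT ONE RECORD FROM THE RUN-RESTRICTED LETTER AT SCALE `c` AND THE BARE DRIFT** of the named numbers: the drift is rescaled by `c`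
(`oneLoopDrift_const_mul` BY NAME, p592392), then §1's consumer at the datum's `fwd`.  NO sign of `c` is read; the anchor and `γ₀ ≤ θ.γ` are unread.
CONDITIONAL; K2⁷ NOT closed. [cite: Balaban1987RG1, Thm 2 p.259 (first sentence), (5.10) p.293 and (2.12)–(2.14) p.268] -/
theorem endpointExistence_of_runRemAt_drift {c : ℝ} (h : RunRemAt F κ θ hP c) {A : ℝ}
    (hdrift : OneLoopDrift (B12Normalization.stepBal 2 F.L) A (beta0OfJs F κ)) :
    EndpointExistence (Node00.datumOfRecord₁₃SepCoPH F 2 θ hP).C.toB12 := by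
  obtain ⟨γ₀, s, hγ₀, -, hcap, hrem, -, hsc⟩ := h
  exact endpointExistence_of_drift_runConstRemainder_survCont (Node00.datumOfRecord₁₃SepCoPH F 2 θ hP).fwd hγ₀ (oneLoopDrift_const_mul hdrift c) hrem hcap hsc

end Letter

/-! ## §3 The two stub TEXTS of edition 3 (κ AFTER θ, scale `θ.cβ`, the item's guard and (B) as INPUTS of 2ᴮ″) and the composition to K2⁷ BY NAME -/

section Stubs

/-- STUB 2ᴮ″ (XL; rows (D4) ∧ B4 at print's constant grade + anchor + (C), RUN-WISE, GIVEN the unity guard and (B)): for every admissible proviso'd Stage-13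
tuple whose datum satisfies B16's printed END STATEMENT, SOME colour datum's `θ.cβ`-scaled named numbers run-shadow the record's β.  κ AFTER θ (CRIT-1 g2 ∕
p592392), `θ.cβ` carried, cap `s ≤ θ.cβ · stepBal 2 F.L`.  A hypothesis shape, never a fact. [cite: Balaban1987RG1, Thm 2 p.259 and (1.20)–(1.22) p.264] -/
def RunRemAtSomeJetsGivenB : Prop :=
  ∀ (F : T4Family) (θ : Node00.Stage13HParams F 2) (hP : θ.Provisos₁₃SepCoPH F 2),
    (θ.ZhUnity F 2 ∧ θ.SlotsNondegenerate₁₃ F 2) → θ.Admissible F 2 →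
    B16.EndStatementBPrinted (Node00.datumOfRecord₁₃SepCoPH F 2 θ hP).C →
    ∃ κ : StepColourData, RunRemAt F κ θ hP θ.cβ

/-- STUB 1ᴮ″ (L; row (D1) at the record, carried by the run-shadowing named jets): the bare drift of `beta0OfJs F κ` at slope `stepBal 2 F.L` for every
colour datum whose scaled numbers run-shadow an admissible proviso'd record.  A hypothesis shape, never a fact. [cite: Balaban1987RG1, (1.3) p.260 and (2.12)–(2.14) p.268] -/
def D1AtRunShadowingJets : Prop :=
  ∀ (F : T4Family) (κ : StepColourData) (θ : Node00.Stage13HParams F 2) (hP : θ.Provisos₁₃SepCoPH F 2), θ.Admissible F 2 →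
    RunRemAt F κ θ hP θ.cβ → ∃ A : ℝ, OneLoopDrift (B12Normalization.stepBal 2 F.L) A (beta0OfJs F κ)

/-- **★★ EDITION 3's COMPOSITION (kernel-checked, no sorry): 1ᴮ″ → 2ᴮ″ → THE CRUX DECL BY NAME**
(`Summit.QuantumFields.YangMills.Theses.BalabanUVNodes.EndpointGivenBR13SepCoPH`, route rev 25).  The item's unity guard `hU` and (B) `hB` are CONSUMED
(handed to 2ᴮ″); the window hypothesis is unused.  CONDITIONAL on the two displayed hypothesis shapes; K2⁷ NOT closed; nothing of Bałaban asserted.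
[cite: Balaban1987RG1, Thm 2 p.259 (first sentence), (5.10) p.293 and (2.12)–(2.14) p.268] -/
theorem EndpointGivenBR13SepCoPH_of_runShadowingJetsGivenB (h₁ : D1AtRunShadowingJets) (h₂ : RunRemAtSomeJetsGivenB) :
    Summit.QuantumFields.YangMills.Theses.BalabanUVNodes.EndpointGivenBR13SepCoPH := by
  intro F θ hP hU hθ hB _hwin
  obtain ⟨κ, hRun⟩ := h₂ F θ hP hU hθ hB
  obtain ⟨A, hdrift⟩ := h₁ F κ θ hP hθ hRun
  exact endpointExistence_of_runRemAt_drift F κ θ hP hRun hdrift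

/-- **DEF-1's STUB 2′ ⟹ STUB 2ᴮ″** (weaker BY NAME: restriction to runs ∕ survivors + three extra inputs). [folklore] -/
theorem runRemAtSomeJetsGivenB_of_remAtSomeJets
    (h : ∀ (F : T4Family) (θ : Node00.Stage13HParams F 2) (hP : θ.Provisos₁₃SepCoPH F 2), θ.Admissible F 2 →
      ∃ κ : StepColourData, RemAt F κ θ hP θ.cβ) :
    RunRemAtSomeJetsGivenB := fun F θ hP _ hθ _ => by
  obtain ⟨κ, hRem⟩ := h F θ hP hθ
  exact ⟨κ, runRemAt_of_remAt F κ θ hP hRem⟩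

/-- **THE (D1) ROAD OF 1ᴮ″ IS DEF-1's**: the anchor-keyed use form (hypothesis VERBATIM = that of DEF-1's `d1AtShadowingJets_of_drift_of_anchor`) gives 1ᴮ″,
because `RunRemAt` keeps the box-wise anchor. [cite: Balaban1987RG1, (1.3) p.260 and (2.12)–(2.14) p.268] -/
theorem d1AtRunShadowingJets_of_drift_of_anchor
    (h : ∀ (F : T4Family) (κ : StepColourData) (θ : Node00.Stage13HParams F 2) (hP : θ.Provisos₁₃SepCoPH F 2), θ.Admissible F 2 →
      ScaleAnchor (Node00.datumOfRecord₁₃SepCoPH F 2 θ hP).βfun (fun k => θ.cβ * beta0OfJs F κ k) →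
      ∃ A : ℝ, OneLoopDrift (B12Normalization.stepBal 2 F.L) A (beta0OfJs F κ)) :
    D1AtRunShadowingJets := fun F κ θ hP hθ hRun => by
  obtain ⟨-, -, -, -, -, -, hanch, -⟩ := hRun
  exact h F κ θ hP hθ hanch

/-- … so with the anchor-keyed (D1) road, 2ᴮ″ ALONE composes to the crux decl. [folklore] -/
theorem EndpointGivenBR13SepCoPH_of_runShadowingJetsGivenB_anchorRoad
    (hD1 : ∀ (F : T4Family) (κ : StepColourData) (θ : Node00.Stage13HParams F 2) (hP : θ.Provisos₁₃SepCoPH F 2), θ.Admissible F 2 →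
      ScaleAnchor (Node00.datumOfRecord₁₃SepCoPH F 2 θ hP).βfun (fun k => θ.cβ * beta0OfJs F κ k) →
      ∃ A : ℝ, OneLoopDrift (B12Normalization.stepBal 2 F.L) A (beta0OfJs F κ))
    (h₂ : RunRemAtSomeJetsGivenB) :
    Summit.QuantumFields.YangMills.Theses.BalabanUVNodes.EndpointGivenBR13SepCoPH :=
  EndpointGivenBR13SepCoPH_of_runShadowingJetsGivenB (d1AtRunShadowingJets_of_drift_of_anchor hD1) h₂

end Stubs

end Summit.QuantumFields.YangMills.Cruxes.EndpointGivenBR13SepCoPH.RunsGivenB3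

end
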